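import Literature.Computability.Cryptography.LiuPassWeakOWFProofs
import Literature.Computability.Cryptography.LiuPassPaddingProofs
import Literature.Computability.Cryptography.LiuPassHeurBricks
import Literature.Computability.Complexity.IterateFP
import Literature.Computability.Complexity.StringEquality
import Literature.Computability.Complexity.PairTruncation
import HarnessLib

/-!
# Discharge of `liuPassHeur_isPPT` (Liu–Pass Thm 4.1: the heuristic `ℋ` is PPT) — Thm 4.1 fully proved

`LiuPassWeakOWF.lean` proves Liu–Pass's Thm 4.1 (FOCS 2020) modulo the efficiency of the candidate
`f` (`liuPassOWF_polyTimeComputable`, discharged in `LiuPassWeakOWFProofs.lean`) and of the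
heuristic `ℋ` (`liuPassHeur_isPPT`). This file proves the latter,
`liuPassHeur_isPPT_holds`, and assembles **Thm 4.1 without remaining facts**:
`weakOWFExist_of_isMildlyHardOnAverage_liuPassKt_holds`.

`ℋ = liuPassHeur U t c j 𝒜` on `z ∈ {0,1}ⁿ` with coins `r` runs the inverter `𝒜` on the `n + c + 1`
queries `⟨1ᴸ, ⟨1ᴸ, ⟨natBits (size L) i, 1z⟩⟩⟩`, `L = lpBase c n + j`, checks each answer with `f`, and
outputs the least verified `i` in binary. As a string function on `⟨z, r⟩` it is

  `heurFn = outStage ∘ iterate roundFn' (n + c + 1 times) ∘ initStage`,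

a loop (the combinator `iterate_mem_FP` of `IterateFP.lean`) over the state
`⟨z, ⟨1ⁱ, ⟨r, ⟨1ᴸ, ⟨1ᶠ, 1ᵛ⟩⟩⟩⟩⟩` (`hState`; `f` = found flag, `v` = first hit so far, else `i`), whose
round is assembled from `FP` bricks by `fanoutFn` (`StringEquality.lean`) and the pair projections:
the query and the target (`nbFn` of `LiuPassHeurBricks.lean`, `List.cons true`), the inverter
(`IsPPT 𝒜`), the candidate (`liuPassOWF_polyTimeComputable_holds`), the comparison (`eqPairFn`,
`unitFn`), the update (`updFn`); the round is made length-controlled on *all* words by truncation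
(`truncPairFn`, `roundFn'`) so that the iteration combinator applies, which does not change it on
well-formed states (`roundFn'_hState`). `initStage` computes `L` (`initLFn`, with
`baseLen_eq_lpBase`) and `outStage` the binary output (`outFn`, with `minD` over the verified
indices = the first hit, `minD_filter_range`). The coin bound is `𝒜`'s bound at the common query
length (`coinLen_liuPassHeur_le`).

## References

* Y. Liu, R. Pass, *On one-way functions and Kolmogorov complexity*, FOCS 2020
  (arXiv:2009.11514), proof of Thm 4.1 ("Our heuristic `ℋ` runs `𝒜(i ‖ z)` for all `i ∈ [n+c]` …
  and outputs the length of the smallest program … ; `ℋ` runs in polynomial time since `𝒜` does").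
* S. Arora, B. Barak, *Computational Complexity: A Modern Approach*, CUP 2009, §1.3, §1.4.1
  (clocked loops), Thm. 2.8, §7.1.
-/

namespace Literature.Computability.Cryptography

open _root_.Computability Polynomial Complexity MetaComplexity

namespace LPH.Prog

/-! ### Pair projections of the state -/

/-- First component. [folklore] -/
noncomputable def pj1 : List Bool → List Bool := fun w => (boolUnpair w).1
/-- Second component. [folklore] -/
noncomputable def pj2 : List Bool → List Bool := fun w => (boolUnpair w).2
/-- `⟨_, ⟨x, _⟩⟩ ↦ x`. [folklore] -/
noncomputable def pj21 : List Bool → List Bool := pj1 ∘ pj2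
/-- `⟨_, ⟨_, ⟨x, _⟩⟩⟩ ↦ x`. [folklore] -/
noncomputable def pj221 : List Bool → List Bool := pj1 ∘ pj2 ∘ pj2
/-- Fourth slot. [folklore] -/
noncomputable def pj2221 : List Bool → List Bool := pj1 ∘ pj2 ∘ pj2 ∘ pj2
/-- Fifth slot. [folklore] -/
noncomputable def pj22221 : List Bool → List Bool := pj1 ∘ pj2 ∘ pj2 ∘ pj2 ∘ pj2
/-- Last slot. [folklore] -/
noncomputable def pj22222 : List Bool → List Bool := pj2 ∘ pj2 ∘ pj2 ∘ pj2 ∘ pj2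

/-- `pj1 ∈ FP`. [folklore] -/
theorem pj1_mem_FP : pj1 ∈ FP := boolUnpairFst_mem_FP
/-- `pj2 ∈ FP`. [folklore] -/
theorem pj2_mem_FP : pj2 ∈ FP := boolUnpairSnd_mem_FP
/-- `pj21 ∈ FP`. [folklore] -/
theorem pj21_mem_FP : pj21 ∈ FP := comp_mem_FP pj1_mem_FP pj2_mem_FP
/-- `pj221 ∈ FP`. [folklore] -/
theorem pj221_mem_FP : pj221 ∈ FP := comp_mem_FP pj1_mem_FP (comp_mem_FP pj2_mem_FP pj2_mem_FP)
/-- `pj2221 ∈ FP`. [folklore] -/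
theorem pj2221_mem_FP : pj2221 ∈ FP := comp_mem_FP pj1_mem_FP (comp_mem_FP pj2_mem_FP (comp_mem_FP pj2_mem_FP pj2_mem_FP))
/-- `pj22221 ∈ FP`. [folklore] -/
theorem pj22221_mem_FP : pj22221 ∈ FP :=
  comp_mem_FP pj1_mem_FP (comp_mem_FP pj2_mem_FP (comp_mem_FP pj2_mem_FP (comp_mem_FP pj2_mem_FP pj2_mem_FP)))
/-- `pj22222 ∈ FP`. [folklore] -/
theorem pj22222_mem_FP : pj22222 ∈ FP :=
  comp_mem_FP pj2_mem_FP (comp_mem_FP pj2_mem_FP (comp_mem_FP pj2_mem_FP (comp_mem_FP pj2_mem_FP pj2_mem_FP)))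

/-- **The state of the loop**: `⟨z, ⟨1ⁱ, ⟨r, ⟨1ᴸ, ⟨1ᶠ, 1ᵛ⟩⟩⟩⟩⟩` — the instance `z` (kept first, so
that the round count `n + c + 1` can be read off it), the round index `i`, the coins `r`, the
query-length parameter `L`, the found flag `f ∈ {0,1}` and the tracked index `v` (the first verified
index once found, else `i`). [folklore] -/
def hState (z r : List Bool) (L i f v : ℕ) : List Bool :=
  boolPair z (boolPair (ones i) (boolPair r (boolPair (ones L) (boolPair (ones f) (ones v)))))

section ProjLemmas

variable (z r : List Bool) (L i f v : ℕ)

/-- Reading `z`. [folklore] -/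
@[simp] theorem pj1_hState : pj1 (hState z r L i f v) = z := by simp [pj1, hState]
/-- Reading `1ⁱ`. [folklore] -/
@[simp] theorem pj21_hState : pj21 (hState z r L i f v) = ones i := by simp [pj21, pj1, pj2, hState]
/-- Reading `r`. [folklore] -/
@[simp] theorem pj221_hState : pj221 (hState z r L i f v) = r := by simp [pj221, pj1, pj2, hState]
/-- Reading `1ᴸ`. [folklore] -/
@[simp] theorem pj2221_hState : pj2221 (hState z r L i f v) = ones L := by simp [pj2221, pj1, pj2, hState]
/-- Reading `1ᶠ`. [folklore] -/
@[simp] theorem pj22221_hState : pj22221 (hState z r L i f v) = ones f := by simp [pj22221, pj1, pj2, hState]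
/-- Reading `1ᵛ`. [folklore] -/
@[simp] theorem pj22222_hState : pj22222 (hState z r L i f v) = ones v := by simp [pj22222, pj2, hState]

end ProjLemmas

/-- Mathlib's unary numerals are `ones`. [folklore] (local twin, scoped to `LPH.Prog`, of `Literature.Computability.Complexity.OCM.unaryEncodeNat_eq_ones`,
`OracleCompositionMachine.lean`, which is not in this file's import closure). -/
theorem unaryEncodeNat_eq_ones : ∀ n : ℕ, unaryEncodeNat n = ones n
  | 0 => rfl
  | n + 1 => by rw [unaryEncodeNat, unaryEncodeNat_eq_ones n, Com.ones_succ]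

/-- The tree's `natBits` (`LiuPassWeakOWF.lean`) is the Complexity-side `Literature.Computability.Complexity.natBits`
(same recursion). [folklore] -/
theorem natBits_eq_natBits : ∀ (D i : ℕ), Literature.Computability.Cryptography.natBits D i = Literature.Computability.Complexity.natBits D i
  | 0, _ => rfl
  | D + 1, i => by rw [Literature.Computability.Cryptography.natBits, Literature.Computability.Complexity.natBits, natBits_eq_natBits D]

/-! ### The round of `ℋ` from `FP` bricks -/

section Round

variable (U : UniversalMachine) (t : Polynomial ℕ) (c : ℕ) (A : RandAlg (List Bool) (List Bool))

/-- The query `⟨1ᴸ, ⟨1ᴸ, ⟨natBits (size L) i, 1z⟩⟩⟩` read off the state. [folklore] -/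
noncomputable def qryFn : List Bool → List Bool :=
  fanoutFn pj2221 (fanoutFn pj2221 (fanoutFn (nbFn ∘ fanoutFn pj2221 pj21) (List.cons true ∘ pj1)))

/-- The target `⟨1ᴸ, ⟨natBits (size L) i, 1z⟩⟩` read off the state. [folklore] -/
noncomputable def tgtFn : List Bool → List Bool :=
  fanoutFn pj2221 (fanoutFn (nbFn ∘ fanoutFn pj2221 pj21) (List.cons true ∘ pj1))

/-- The inverter as a string function `⟨q, r⟩ ↦ 𝒜(q; r)`. [folklore] -/
noncomputable def invFn : List Bool → List Bool := Function.uncurry A.run ∘ boolUnpair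

/-- The checked answer `f(𝒜(query; r))`. [folklore] -/
noncomputable def faFn : List Bool → List Bool := liuPassOWF U t c ∘ invFn A ∘ fanoutFn (qryFn) pj221

/-- The hit flag of the round in unary: `1^{[f(𝒜(query; r)) = target]}`. [folklore] -/
noncomputable def hitFn : List Bool → List Bool := unitFn ∘ eqPairFn ∘ fanoutFn (faFn U t c A) tgtFn

/-- The update of the pair `⟨1ᶠ, 1ᵛ⟩`. [folklore] -/
noncomputable def updStage : List Bool → List Bool :=
  updFn ∘ fanoutFn pj22221 (fanoutFn (hitFn U t c A) pj22222)

/-- **One round of `ℋ`** on the state. [folklore] -/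
noncomputable def roundFn : List Bool → List Bool :=
  fanoutFn pj1 (fanoutFn (List.cons true ∘ pj21) (fanoutFn pj221 (fanoutFn pj2221 (updStage U t c A))))

/-- The round made length-controlled on every word: `w ↦ (roundFn w) ↾ (|w| + 5)`. [folklore] -/
noncomputable def roundFn' : List Bool → List Bool :=
  pj2 ∘ truncPairFn (X + 5) ∘ fanoutFn id (roundFn U t c A)

variable {A}

/-- `invFn 𝒜 ∈ FP` for a PPT `𝒜`. [folklore] -/
theorem invFn_mem_FP (hA : IsPPT A id) : invFn A ∈ FP :=
  PolyTimeComputable.comp_holds (by simpa [invFn] using hA.1) polyTimeComputable_boolUnpair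

/-- `qryFn ∈ FP`. [folklore] -/
theorem qryFn_mem_FP : qryFn ∈ FP :=
  fanoutFn_mem_FP pj2221_mem_FP (fanoutFn_mem_FP pj2221_mem_FP (fanoutFn_mem_FP
    (comp_mem_FP nbFn_mem_FP (fanoutFn_mem_FP pj2221_mem_FP pj21_mem_FP)) (comp_mem_FP (cons_mem_FP true) pj1_mem_FP)))

/-- `tgtFn ∈ FP`. [folklore] -/
theorem tgtFn_mem_FP : tgtFn ∈ FP :=
  fanoutFn_mem_FP pj2221_mem_FP (fanoutFn_mem_FP
    (comp_mem_FP nbFn_mem_FP (fanoutFn_mem_FP pj2221_mem_FP pj21_mem_FP)) (comp_mem_FP (cons_mem_FP true) pj1_mem_FP))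

/-- `roundFn ∈ FP` for a PPT `𝒜`. [cite: AroraBarakCC2009, Thm. 2.8] -/
theorem roundFn_mem_FP (hA : IsPPT A id) : roundFn U t c A ∈ FP := by
  have hfa : faFn U t c A ∈ FP :=
    comp_mem_FP (liuPassOWF_polyTimeComputable_holds U t c) (comp_mem_FP (invFn_mem_FP hA)
      (fanoutFn_mem_FP qryFn_mem_FP pj221_mem_FP))
  have hhit : hitFn U t c A ∈ FP :=
    comp_mem_FP unitFn_mem_FP (comp_mem_FP eqPairFn_mem_FP (fanoutFn_mem_FP hfa tgtFn_mem_FP))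
  have hupd : updStage U t c A ∈ FP :=
    comp_mem_FP updFn_mem_FP (fanoutFn_mem_FP pj22221_mem_FP (fanoutFn_mem_FP hhit pj22222_mem_FP))
  exact fanoutFn_mem_FP pj1_mem_FP (fanoutFn_mem_FP (comp_mem_FP (cons_mem_FP true) pj21_mem_FP)
    (fanoutFn_mem_FP pj221_mem_FP (fanoutFn_mem_FP pj2221_mem_FP hupd)))

/-- `roundFn' ∈ FP` for a PPT `𝒜`. [cite: AroraBarakCC2009, Thm. 2.8] -/
theorem roundFn'_mem_FP (hA : IsPPT A id) : roundFn' U t c A ∈ FP :=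
  comp_mem_FP pj2_mem_FP (comp_mem_FP (truncPairFn_mem_FP _) (fanoutFn_mem_FP (PolyTimeComputable.id _) (roundFn_mem_FP U t c hA)))

/-- The truncated round grows every word by at most `5`. [folklore] -/
theorem length_roundFn'_le (w : List Bool) : (roundFn' U t c A w).length ≤ w.length + 5 := by
  simp [roundFn', pj2, List.length_take]

variable (A)

/-- The verification bit of the index `i`: "`𝒜`'s answer on the `i`-th query is an `f`-preimage
of the target". [Y. Liu, R. Pass, FOCS 2020, proof of Thm 4.1] [folklore] -/
noncomputable def hitP (z r : List Bool) (L i : ℕ) : Bool :=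
  decide (liuPassOWF U t c (A.run (lpQuery L i z) r) = lpTarget L i z)

/-- The update of `(f, v)` by a verification bit. [folklore] -/
def stepFV (h : Bool) (p : ℕ × ℕ) : ℕ × ℕ := if p.1 = 0 ∧ h = false then (0, p.2 + 1) else (1, p.2)

/-- **Semantics of the round on a state** (flag `f ≤ 1`). [folklore] -/
theorem roundFn_hState (z r : List Bool) (L i f v : ℕ) :
    roundFn U t c A (hState z r L i f v) =
      hState z r L (i + 1) (stepFV (hitP U t c A z r L i) (f, v)).1 (stepFV (hitP U t c A z r L i) (f, v)).2 := by
  have hq : qryFn (hState z r L i f v) = lpQuery L i z := by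
    simp [qryFn, lpQuery, lpTarget, unaryEncodeNat_eq_ones, natBits_eq_natBits, nbFn_boolPair]
  have htg : tgtFn (hState z r L i f v) = lpTarget L i z := by
    simp [tgtFn, lpTarget, unaryEncodeNat_eq_ones, natBits_eq_natBits, nbFn_boolPair]
  have hfa : faFn U t c A (hState z r L i f v) = liuPassOWF U t c (A.run (lpQuery L i z) r) := by
    simp [faFn, invFn, hq]
  have hhit : hitFn U t c A (hState z r L i f v) = ones (if hitP U t c A z r L i then 1 else 0) := by
    simp [hitFn, hfa, htg, eqPairFn_boolPair, hitP]
  have hupd : updStage U t c A (hState z r L i f v) =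
      boolPair (ones (stepFV (hitP U t c A z r L i) (f, v)).1) (ones (stepFV (hitP U t c A z r L i) (f, v)).2) := by
    simp only [updStage, Function.comp_apply, fanoutFn_apply, pj22221_hState, pj22222_hState, hhit, updFn_boolPair, stepFV]
    cases hitP U t c A z r L i <;> by_cases hf : f = 0 <;> simp [hf]
  simp only [roundFn, fanoutFn_apply, Function.comp_apply, pj1_hState, pj21_hState, pj221_hState, pj2221_hState, hupd]
  simp only [hState, Com.ones_succ]

/-- States grow by at most `5` per round: `i` by a doubled unit, the flag by at most a doubled unit,
`v` by at most one. [folklore] -/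
theorem length_roundFn_hState_le (z r : List Bool) (L i f v : ℕ) :
    (roundFn U t c A (hState z r L i f v)).length ≤ (hState z r L i f v).length + 5 := by
  rw [roundFn_hState]
  simp only [hState, length_boolPair, List.length_replicate, stepFV]
  split_ifs <;> simp <;> omega

/-- **On states the truncation is invisible.** [folklore] -/
theorem roundFn'_hState (z r : List Bool) (L i f v : ℕ) :
    roundFn' U t c A (hState z r L i f v) = roundFn U t c A (hState z r L i f v) := by
  have h := length_roundFn_hState_le U t c A z r L i f v
  simp only [roundFn', Function.comp_apply, fanoutFn_apply, id, truncPairFn_boolPair, pj2, boolUnpair_boolPair,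
    eval_add, eval_X, eval_ofNat]
  exact List.take_of_length_le h

/-- The `(f, v)`-track after `k` rounds. [folklore] -/
noncomputable def trk (z r : List Bool) (L : ℕ) : ℕ → ℕ × ℕ
  | 0 => (0, 0)
  | k + 1 => stepFV (hitP U t c A z r L k) (trk z r L k)

/-- **`k` truncated rounds from the initial state.** [folklore] -/
theorem iterate_roundFn'_hState (z r : List Bool) (L : ℕ) : ∀ k : ℕ,
    (roundFn' U t c A)^[k] (hState z r L 0 0 0) = hState z r L k (trk U t c A z r L k).1 (trk U t c A z r L k).2
  | 0 => rfl
  | k + 1 => by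
    rw [Function.iterate_succ_apply', iterate_roundFn'_hState z r L k, roundFn'_hState, roundFn_hState]
    rfl

/-- The first verified index below `k`, else `k`. [folklore] -/
noncomputable def firstHit (z r : List Bool) (L : ℕ) : ℕ → ℕ
  | 0 => 0
  | k + 1 => if firstHit z r L k < k then firstHit z r L k else if hitP U t c A z r L k then k else k + 1

/-- `firstHit ≤ k`. [folklore] -/
theorem firstHit_le (z r : List Bool) (L : ℕ) : ∀ k, firstHit U t c A z r L k ≤ k
  | 0 => le_rfl
  | k + 1 => by rw [firstHit]; have := firstHit_le z r L k; split_ifs <;> omega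

/-- `firstHit < k` iff some index below `k` is verified, and then it is the least one. [folklore] -/
theorem firstHit_spec (z r : List Bool) (L : ℕ) : ∀ k,
    (firstHit U t c A z r L k < k ↔ ∃ i < k, hitP U t c A z r L i = true) ∧
    (firstHit U t c A z r L k < k → hitP U t c A z r L (firstHit U t c A z r L k) = true ∧
      ∀ i < firstHit U t c A z r L k, hitP U t c A z r L i = false)
  | 0 => by simp [firstHit]
  | k + 1 => by
    obtain ⟨ih1, ih2⟩ := firstHit_spec z r L k
    have hle := firstHit_le U t c A z r L k
    rw [firstHit]
    by_cases hlt : firstHit U t c A z r L k < k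
    · rw [if_pos hlt]
      obtain ⟨hA, hmin⟩ := ih2 hlt
      exact ⟨⟨fun _ => ⟨_, by omega, hA⟩, fun _ => by omega⟩, fun _ => ⟨hA, hmin⟩⟩
    · rw [if_neg hlt]
      have hnone : ∀ i < k, hitP U t c A z r L i = false := fun i hi => by
        by_contra h
        exact hlt (ih1.2 ⟨i, hi, by simpa using h⟩)
      by_cases hB : hitP U t c A z r L k = true
      · rw [if_pos hB]
        exact ⟨⟨fun _ => ⟨k, by omega, hB⟩, fun _ => by omega⟩, fun _ => ⟨hB, hnone⟩⟩
      · rw [if_neg hB]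
        refine ⟨⟨fun h => absurd h (by omega), ?_⟩, fun h => absurd h (by omega)⟩
        rintro ⟨i, hi, hAi⟩
        rcases Nat.lt_succ_iff_lt_or_eq.1 hi with hi | rfl
        · rw [hnone i hi] at hAi; exact absurd hAi (by simp)
        · exact absurd hAi hB

/-- **The track is the found flag and the first hit.** [folklore] -/
theorem trk_eq (z r : List Bool) (L : ℕ) : ∀ k,
    trk U t c A z r L k = (if firstHit U t c A z r L k < k then 1 else 0, firstHit U t c A z r L k)
  | 0 => by simp [trk, firstHit]
  | k + 1 => by
    rw [trk, trk_eq z r L k]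
    have hle := firstHit_le U t c A z r L k
    by_cases hlt : firstHit U t c A z r L k < k
    · have hfh : firstHit U t c A z r L (k + 1) = firstHit U t c A z r L k := by rw [firstHit, if_pos hlt]
      rw [hfh, if_pos hlt, if_pos (show firstHit U t c A z r L k < k + 1 by omega)]
      simp [stepFV]
    · have heq : firstHit U t c A z r L k = k := by omega
      rw [if_neg hlt]
      cases hh : hitP U t c A z r L k
      · have hfh : firstHit U t c A z r L (k + 1) = k + 1 := by simp [firstHit, hlt, hh]
        rw [hfh, heq]; simp [stepFV]
      · have hfh : firstHit U t c A z r L (k + 1) = k := by simp [firstHit, hlt, hh]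
        rw [hfh, heq]; simp [stepFV]

/-- `minD` over the verified indices below `d` is the first hit (else `d`). [folklore] -/
theorem minD_filter_range (z r : List Bool) (L d : ℕ) :
    minD d ((List.range d).filter fun i => hitP U t c A z r L i) = firstHit U t c A z r L d := by
  obtain ⟨h1, h2⟩ := firstHit_spec U t c A z r L d
  have hle := firstHit_le U t c A z r L d
  by_cases hlt : firstHit U t c A z r L d < d
  · obtain ⟨hA, hmin⟩ := h2 hlt
    apply le_antisymm
    · exact minD_le_of_mem (by simp [List.mem_filter, hlt, hA])
    · refine le_minD (fun b hb => ?_) hle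
      simp only [List.mem_filter, List.mem_range] at hb
      by_contra hlt'
      rw [hmin b (by omega)] at hb
      exact absurd hb.2 (by simp)
  · have heq : firstHit U t c A z r L d = d := by omega
    have hnil : ((List.range d).filter fun i => hitP U t c A z r L i) = [] := by
      rw [List.filter_eq_nil_iff]
      intro i hi hAi
      exact hlt (h1.2 ⟨i, List.mem_range.1 hi, hAi⟩)
    rw [hnil, heq]; rfl

end Round

/-! ### The base length and the coin budget -/

/-- `minD` of a filtered range is the least index satisfying the predicate, else the bound — here
for the admissibility predicate of `lpCand`: **`lpBase c n = baseLen (n + c) (2(n+c)+3)`**. [folklore] -/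
theorem baseLen_eq_lpBase (c n : ℕ) : INIT.baseLen (n + c) (lpBound c n) = lpBase c n := by
  have hB : lpBound c n = 2 * (n + c) + 3 := rfl
  obtain ⟨h1, h2⟩ := INIT.baseLen_adm (n + c) (lpBound c n)
  have hle := INIT.baseLen_le (n + c) (lpBound c n)
  unfold lpBase
  rw [← hB]
  have hcand : ∀ L, L ∈ lpCand c n ↔ L < lpBound c n ∧ INIT.Adm (n + c) L := fun L => by
    simp [lpCand, INIT.Adm, hB, List.mem_filter, List.mem_range]
  by_cases hlt : INIT.baseLen (n + c) (lpBound c n) < lpBound c n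
  · obtain ⟨hA, hmin⟩ := h2 hlt
    apply le_antisymm
    · refine le_minD (fun b hb => ?_) hle
      obtain ⟨hb1, hb2⟩ := (hcand b).1 hb
      by_contra h
      exact hmin b (by omega) hb2
    · exact minD_le_of_mem ((hcand _).2 ⟨hlt, hA⟩)
  · have heq : INIT.baseLen (n + c) (lpBound c n) = lpBound c n := by omega
    have hnil : lpCand c n = [] := by
      rw [List.eq_nil_iff_forall_not_mem]
      intro L hL
      obtain ⟨hL1, hL2⟩ := (hcand L).1 hL
      exact hlt (h1.2 ⟨L, hL1, hL2⟩)
    rw [hnil, heq]; rfl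

/-- `lpBase c n ≤ 2(n+c)+3`. [folklore] -/
theorem lpBase_le (c n : ℕ) : lpBase c n ≤ 2 * (n + c) + 3 := by
  rw [← baseLen_eq_lpBase]; exact INIT.baseLen_le _ _

/-- The common query length is linear: `lpQueryLen n (lpBase c n + j) ≤ 15n + 14c + 7j + 28`. [folklore] -/
theorem lpQueryLen_le (c j n : ℕ) : lpQueryLen n (lpBase c n + j) ≤ 15 * n + 14 * c + 7 * j + 28 := by
  have hL := lpBase_le c n
  have hs : Nat.size (lpBase c n + j) ≤ lpBase c n + j := Nat.size_le.2 (Nat.lt_two_pow_self)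
  unfold lpQueryLen
  omega

/-- **The coin budget of `ℋ` is polynomial**: it is `𝒜`'s budget on the common query length.
[Y. Liu, R. Pass, FOCS 2020, proof of Thm 4.1] [folklore] -/
theorem coinLen_liuPassHeur_le (U : UniversalMachine) (t : Polynomial ℕ) (c j : ℕ) {A : RandAlg (List Bool) (List Bool)}
    {pA : Polynomial ℕ} (hpA : ∀ n, A.coinLen n ≤ pA.eval n) (n : ℕ) :
    (liuPassHeur U t c j A).coinLen n ≤ (pA.comp (15 * X + Polynomial.C (14 * c + 7 * j + 28))).eval n := by
  show A.coinLen (lpQueryLen n (lpBase c n + j)) ≤ _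
  refine (hpA _).trans ?_
  rw [eval_comp]
  exact TM2Iter.eval_mono pA (by simp; have := lpQueryLen_le c j n; omega)

/-! ### The whole heuristic as a string function -/

section Whole

variable (U : UniversalMachine) (t : Polynomial ℕ) (c j : ℕ) (A : RandAlg (List Bool) (List Bool))

/-- The initial state from `⟨z, r⟩`: `⟨z, ⟨1⁰, ⟨r, ⟨1ᴸ, ⟨1⁰, 1⁰⟩⟩⟩⟩⟩`, `L = lpBase c |z| + j`. [folklore] -/
noncomputable def initStage : List Bool → List Bool :=
  fanoutFn pj1 (fanoutFn (fun _ => []) (fanoutFn pj2 (fanoutFn (initLFn c j ∘ pj1) (fanoutFn (fun _ => []) (fun _ => [])))))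

/-- The iteration: `|z| + c + 1` truncated rounds, the count read off the first component. [folklore] -/
noncomputable def iterStage : List Bool → List Bool :=
  fun w => (roundFn' U t c A)^[(X + Polynomial.C (c + 1)).eval (boolUnpair w).1.length] w

/-- The output: `encodeNat (if found then v else n + c + 1)` from `⟨1ᶠ, ⟨1ᵛ, 1ⁿ⟩⟩`. [folklore] -/
noncomputable def outStage : List Bool → List Bool :=
  outFn c ∘ fanoutFn pj22221 (fanoutFn pj22222 (onesFn ∘ pj1))

/-- **`ℋ` as a string function on `⟨z, r⟩`.** [folklore] -/
noncomputable def heurFn : List Bool → List Bool := outStage c ∘ iterStage U t c A ∘ initStage c j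

variable {A}

/-- `heurFn ∈ FP` for a PPT `𝒜`. [cite: AroraBarakCC2009, Thm. 2.8] -/
theorem heurFn_mem_FP (hA : IsPPT A id) : heurFn U t c j A ∈ FP := by
  have hinit : initStage c j ∈ FP :=
    fanoutFn_mem_FP pj1_mem_FP (fanoutFn_mem_FP (const_mem_FP []) (fanoutFn_mem_FP pj2_mem_FP
      (fanoutFn_mem_FP (comp_mem_FP (initLFn_mem_FP c j) pj1_mem_FP) (fanoutFn_mem_FP (const_mem_FP []) (const_mem_FP [])))))
  have hiter : iterStage U t c A ∈ FP :=
    iterate_mem_FP (roundFn'_mem_FP U t c hA) 5 (length_roundFn'_le U t c) (X + Polynomial.C (c + 1))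
  have hout : outStage c ∈ FP :=
    comp_mem_FP (outFn_mem_FP c) (fanoutFn_mem_FP pj22221_mem_FP (fanoutFn_mem_FP pj22222_mem_FP (comp_mem_FP onesFn_mem_FP pj1_mem_FP)))
  exact comp_mem_FP hout (comp_mem_FP hiter hinit)

variable (A)

/-- **Value of `heurFn` on `⟨z, r⟩`: `encodeNat (ℋ(z; r))`.** [folklore] -/
theorem heurFn_boolPair (z r : List Bool) :
    heurFn U t c j A (boolPair z r) = encodeNat ((liuPassHeur U t c j A).run z r) := by
  have hinit : initStage c j (boolPair z r) = hState z r (lpBase c z.length + j) 0 0 0 := by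
    simp [initStage, hState, pj1, pj2, initLFn, baseLen_eq_lpBase]
  have hiter : iterStage U t c A (hState z r (lpBase c z.length + j) 0 0 0) =
      hState z r (lpBase c z.length + j) (z.length + c + 1)
        (trk U t c A z r (lpBase c z.length + j) (z.length + c + 1)).1
        (trk U t c A z r (lpBase c z.length + j) (z.length + c + 1)).2 := by
    simp only [iterStage, hState, boolUnpair_boolPair, eval_add, eval_X, eval_C]
    exact iterate_roundFn'_hState U t c A z r _ _
  have hout : ∀ (L k f' v' : ℕ), outStage c (hState z r L k f' v') = encodeNat (if f' = 0 then z.length + c + 1 else v') := by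
    intro L k f' v'
    simp only [outStage, Function.comp_apply, fanoutFn_apply, pj22221_hState, pj22222_hState, pj1_hState]
    rw [onesFn, unaryEncodeNat_eq_ones, outFn_boolPair]
  rw [heurFn, Function.comp_apply, Function.comp_apply, hinit, hiter, trk_eq, hout]
  apply congrArg encodeNat
  have hmin := minD_filter_range U t c A z r (lpBase c z.length + j) (z.length + c + 1)
  have hle := firstHit_le U t c A z r (lpBase c z.length + j) (z.length + c + 1)
  have hrun : (liuPassHeur U t c j A).run z r =
      minD (z.length + c + 1) ((List.range (z.length + c + 1)).filter fun i => hitP U t c A z r (lpBase c z.length + j) i) := rfl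
  rw [hrun, hmin]
  by_cases hlt : firstHit U t c A z r (lpBase c z.length + j) (z.length + c + 1) < z.length + c + 1
  · rw [if_pos hlt, if_neg (by norm_num)]
  · rw [if_neg hlt, if_pos rfl]; omega

end Whole

end LPH.Prog

/-! ### The efficiency fact and Thm 4.1 -/

open LPH.Prog in
/-- **Discharge of `liuPassHeur_isPPT`** (Liu–Pass, FOCS 2020, proof of Thm 4.1: "`ℋ` runs in
polynomial time since `𝒜` does"): for every PPT inverter `𝒜` and slot `j`, the heuristic
`liuPassHeur U t c j 𝒜` is PPT — its run function is `heurFn ∈ FP` transported to the pair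
presentation, and its coin budget is `𝒜`'s at the common query length.
[cite: LiuPassFOCS2020, Thm 4.1 (proof)] -/
theorem liuPassHeur_isPPT_holds : liuPassHeur_isPPT := by
  intro U t c j A hA
  refine ⟨?_, ?_⟩
  · obtain ⟨p, M, hM⟩ := heurFn_mem_FP U t c j hA
    refine ⟨p, M, fun q => ?_⟩
    have h := hM (boolPair q.1 q.2)
    rw [id, heurFn_boolPair] at h
    exact h
  · obtain ⟨pA, hpA⟩ := hA.2
    exact ⟨pA.comp (15 * X + Polynomial.C (14 * c + 7 * j + 28)), coinLen_liuPassHeur_le U t c j hpA⟩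

open LPH.Prog in
/-- **Liu–Pass 2020, Thm 4.1, fully proved**: for every universal machine `U` and polynomial
`t(n) ≥ (1+ε)n`, if `K^t` is mildly hard-on-average then weak one-way functions exist (the named fact
`weakOWFExist_of_isMildlyHardOnAverage_liuPassKt` of `Sweep1Proofs.lean`, from the real proof
`isWeaklyOneWay_liuPassOWF_of` and the two efficiency facts discharged in this file and in
`LiuPassWeakOWFProofs.lean`). [Y. Liu, R. Pass, FOCS 2020, Thm 4.1] [cite: LiuPassFOCS2020, Thm 4.1] -/
theorem weakOWFExist_of_isMildlyHardOnAverage_liuPassKt_holds : weakOWFExist_of_isMildlyHardOnAverage_liuPassKt :=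
  weakOWFExist_of_isMildlyHardOnAverage_liuPassKt_of liuPassOWF_polyTimeComputable_holds liuPassHeur_isPPT_holds

open LPH.Prog in
/-- **S02, direction `←`, from Yao's amplification alone**: for every `U` and polynomial
`t(n) ≥ (1+ε)n`, mild average-case hardness of `K^t` gives one-way functions, given
`weakOWFExist_iff_OWFExist` (S05). [Y. Liu, R. Pass, FOCS 2020, Thm 4.1 + Thm 2.3 (Yao)]
[cite: LiuPassFOCS2020, Thm 4.1] -/
theorem OWFExist_of_isMildlyHardOnAverage_liuPassKt_of_Yao (hYao : weakOWFExist_iff_OWFExist)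
    (U : UniversalMachine) (t : Polynomial ℕ) {ε : ℝ} (hε : 0 < ε) (ht : ∀ n : ℕ, (1 + ε) * n ≤ ((t.eval n : ℕ) : ℝ))
    (hK : IsMildlyHardOnAverage encodeNat (liuPassKt U t)) : OWFExist :=
  hYao.1 (weakOWFExist_of_isMildlyHardOnAverage_liuPassKt_holds U t hε ht hK)

open LPH.Prog in
/-- **S02 from two named facts**: Yao's amplification (`weakOWFExist_iff_OWFExist`, S05) and
Liu–Pass's Thm 5.5 (`condEPPRG_of_OWFExist`); everything else — Thms 4.1, 5.2, the padding of 5.6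
and all efficiency claims — is proved in the tree.
[Y. Liu, R. Pass, FOCS 2020, Thm 1.1 and the remark after it] [cite: LiuPassFOCS2020, Thm 1.1] -/
theorem OWFExist_iff_isMildlyHardOnAverage_liuPassKt_of_Yao_h55 (hYao : weakOWFExist_iff_OWFExist)
    (h55 : condEPPRG_of_OWFExist) : OWFExist_iff_isMildlyHardOnAverage_liuPassKt :=
  OWFExist_iff_isMildlyHardOnAverage_liuPassKt_of_four liuPassOWF_polyTimeComputable_holds liuPassHeur_isPPT_holds hYao h55

end Literature.Computability.Cryptography
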